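import Mathlib
import Summits.ValiantsHypothesis.ValiantsHypothesis.Theses.ValuativeGCT
import Literature.Computability.AlgebraicComplexity.OrbitClosureWeights
import Literature.NumberTheory.DiophantineGeometry.SchurWeylPlethysmKroneckerBoundProofs
import Literature.NumberTheory.DiophantineGeometry.SchurWeylPlethysmOrbitWeightsProofs
import Literature.Computability.AlgebraicComplexity.GCTObstructionsWeightForm
import Summits.ValiantsHypothesis.ValiantsHypothesis.Theorems.ValuativeGCTCutBitesHwExtraction

/-!
# The per side of the four-row bridge: the generic orbit map, functions of the kept rows, and
highest-weight vectors inside `ℂ[End W]` (four-row bridge, part 2)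

Infrastructure for stub `stub_fourRowBridge` of line `four-row-count` for crux
`ValuativeGCT.ValuativeFlip` (stmt-ValiantsHypothesis-12624).  `W = ℂ^{m×m}`,
`R = ℂ[End W] = MvPolynomial (MatIdx m × MatIdx m) ℂ` (variables `X (j, i)`, row slot `j`, matrix
position `i`), `R_coef = ℂ[Sym^m W] = MvPolynomial (DegIdx (MatIdx m) m) ℂ`, and
`Φ = genericOrbitMap f m : R_coef → R`, `F ↦ (A ↦ F(A · f))`.

* `frb_leftAct_inv_genericOrbitMap`: `Φ` intertwines `coordRep` and the left translation,
  `(A ↦ Φ F (g⁻¹ A)) = Φ (g · F)` (`eval_genericOrbitMap`, `aeval_formCoeff_coordSubst`, `GL`-density);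
* `frb_coordSubst_mem_supported`, `frb_genericOrbitMap_mem_supported`: polynomials in the coefficients of
  the monomials in the KEPT variables are preserved by `g ·` when `g⁻¹` fixes the other variables, and
  `Φ` maps them to functions of the kept ROWS of `A`;
* `frb_mk_mem_highestWeightSpace`, `frb_finrank_hwsp_inf_map_le_orbitMultiplicity`: a `B`-semi-invariant
  of weight `χ` (crux Borel clause) inside `Φ(N)` is the image of a highest-weight CLASS of `ℂ[Δ_m(f)]`
  (`orbitCoordToPoly` is injective and equivariant), so `dim (HWSP(χ) ⊓ Φ(N)) ≤ orbitMultiplicity f m χ`;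
* `frb_exists_partition_of_hwv`: for the padded permanent such a `χ` in degree `δ` is `λ*` with
  `λ ⊢ mδ`, `≤ m²` parts (`exists_eq_toMatIdx_of_hasHighestWeight_paddedPerOrbitRep` + size pinning);
  `frb_card_parts_le_of_toMatIdx_eq_zero`: if `λ*` vanishes off the last `L` slots then `ℓ(λ) ≤ L`.
Mulmuley–Sohoni 2001 §4–§5; BLMW 2011 §5.2. [folklore]
-/

-- `Summit.ValiantsHypothesis.ValiantsHypothesis.…` is the tree's mandated single-conjunct layout (Sub = Summit).
set_option linter.dupNamespace false

namespace Summit.ValiantsHypothesis.ValiantsHypothesis.Theorems.ValuativeFlip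

open MvPolynomial
open scoped BigOperators Matrix
open Literature.NumberTheory.DiophantineGeometry
open Literature.Computability.AlgebraicComplexity
open Summit.ValiantsHypothesis.ValiantsHypothesis.Theorems.CutBitesAdjugate

noncomputable section

section GenericOrbit

variable {m : ℕ}

/-- Evaluating an `aeval`-substitution at a point is evaluating at the evaluated substitution. [folklore] -/
theorem frb_eval_aeval {ι τ : Type*} (x : τ → ℂ) (h : ι → MvPolynomial τ ℂ) (P : MvPolynomial ι ℂ) :
    MvPolynomial.eval x (MvPolynomial.aeval h P) = MvPolynomial.eval (fun i => MvPolynomial.eval x (h i)) P := by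
  rw [aeval_eq_bind₁]
  exact eval₂Hom_bind₁ _ _ _ _

/-- **Equivariance of the generic orbit map.**  Left translation by `g⁻¹` of `Φ F = (A ↦ F(A · f))` is
`Φ (g · F)`: both evaluate at `A` to `F(g⁻¹ A · f)` (`eval_genericOrbitMap`, `aeval_formCoeff_coordSubst`,
`linSubst_mul`).  Mulmuley–Sohoni 2001 §4. [folklore] -/
theorem frb_leftAct_inv_genericOrbitMap (f : MvPolynomial (MatIdx m) ℂ) (g : GL (MatIdx m) ℂ)
    (F : MvPolynomial (DegIdx (MatIdx m) m) ℂ) :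
    MvPolynomial.aeval (R := ℂ) (fun q : MatIdx m × MatIdx m =>
        ∑ l : MatIdx m, ((g⁻¹ : GL (MatIdx m) ℂ) : Matrix (MatIdx m) (MatIdx m) ℂ) q.1 l •
          (X (l, q.2) : MvPolynomial (MatIdx m × MatIdx m) ℂ)) (genericOrbitMap f m F) =
      genericOrbitMap f m (coordSubst m g F) := by
  apply MvPolynomial.funext
  intro x
  rw [hwx_eval_leftAct]
  have h1 : (fun q : MatIdx m × MatIdx m =>
      ∑ l : MatIdx m, ((g⁻¹ : GL (MatIdx m) ℂ) : Matrix (MatIdx m) (MatIdx m) ℂ) q.1 l * x (l, q.2)) =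
      fun ij : MatIdx m × MatIdx m => (((g⁻¹ : GL (MatIdx m) ℂ) : Matrix (MatIdx m) (MatIdx m) ℂ) *
        Matrix.of (fun i j : MatIdx m => x (i, j))) ij.1 ij.2 := by
    funext q
    simp [Matrix.mul_apply]
  have h2 : MvPolynomial.eval x (genericOrbitMap f m (coordSubst m g F)) =
      MvPolynomial.eval (fun ij : MatIdx m × MatIdx m => Matrix.of (fun i j : MatIdx m => x (i, j)) ij.1 ij.2)
        (genericOrbitMap f m (coordSubst m g F)) := rfl
  rw [h1, eval_genericOrbitMap, h2, eval_genericOrbitMap, aeval_formCoeff_coordSubst, linSubstRep_apply,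
    linSubst_mul, AlgHom.comp_apply]

/-- A monomial in the kept variables does not occur in `M · X^e` when `e` involves a non-kept variable
that `M` fixes (the factor `X_{i₀}^{e i₀}` survives). [folklore] -/
theorem frb_coeff_linSubst_monomial_eq_zero (p : MatIdx m → Prop) (M : Matrix (MatIdx m) (MatIdx m) ℂ)
    (hcol : ∀ i, ¬ p i → ∀ a, M a i = if a = i then 1 else 0)
    {d e : MatIdx m →₀ ℕ} (hd : ∀ i, ¬ p i → d i = 0) {i₀ : MatIdx m} (hi₀ : ¬ p i₀) (hei₀ : e i₀ ≠ 0) :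
    coeff d (linSubst (MatIdx m) ℂ M (monomial e (1 : ℂ))) = 0 := by
  classical
  have hX : (∑ j : MatIdx m, M j i₀ • (X j : MvPolynomial (MatIdx m) ℂ)) = X i₀ := by
    simp only [hcol i₀ hi₀, ite_smul, one_smul, zero_smul, Finset.sum_ite_eq', Finset.mem_univ, if_true]
  simp only [linSubst, aeval_monomial, map_one, one_mul]
  rw [Finsupp.prod, ← Finset.mul_prod_erase _ _ (Finsupp.mem_support_iff.mpr hei₀), hX, X_pow_eq_monomial,
    coeff_monomial_mul', if_neg]
  rw [Finsupp.single_le_iff, hd i₀ hi₀]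
  exact fun h => hei₀ (Nat.le_zero.mp h)

/-- **`g ·` preserves the polynomials in the kept coefficients** when `g⁻¹` fixes the non-kept variables
(its non-kept columns are unit vectors): `coordSubst m g` substitutes for a kept coefficient `X_d` the
combination `∑_e coeff_d (g⁻¹ · X^e) X_e`, in which only kept `e` occur. [folklore] -/
theorem frb_coordSubst_mem_supported (p : MatIdx m → Prop) (g : GL (MatIdx m) ℂ)
    (hcol : ∀ i, ¬ p i → ∀ a, ((g⁻¹ : GL (MatIdx m) ℂ) : Matrix (MatIdx m) (MatIdx m) ℂ) a i = if a = i then 1 else 0)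
    {F : MvPolynomial (DegIdx (MatIdx m) m) ℂ}
    (hF : F ∈ MvPolynomial.supported ℂ {d : DegIdx (MatIdx m) m | ∀ i, ¬ p i → d.1 i = 0}) :
    coordSubst m g F ∈ MvPolynomial.supported ℂ {d : DegIdx (MatIdx m) m | ∀ i, ¬ p i → d.1 i = 0} := by
  classical
  have key : ∀ (d e : DegIdx (MatIdx m) m), (∀ i, ¬ p i → d.1 i = 0) → (¬ ∀ i, ¬ p i → e.1 i = 0) →
      coeff d.1 (linSubstRep (MatIdx m) ℂ g⁻¹ (monomial e.1 (1 : ℂ))) = 0 := by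
    intro d e hd he
    push Not at he
    obtain ⟨i₀, hi₀, hei₀⟩ := he
    rw [linSubstRep_apply]
    exact frb_coeff_linSubst_monomial_eq_zero p _ hcol hd hi₀ hei₀
  rw [supported_eq_range_rename, AlgHom.mem_range] at hF
  obtain ⟨F₀, rfl⟩ := hF
  change coordSubst m g (rename (Subtype.val : {d : DegIdx (MatIdx m) m // ∀ i, ¬ p i → d.1 i = 0} →
    DegIdx (MatIdx m) m) F₀) ∈ _
  rw [coordSubst, aeval_rename]
  refine (?_ : (MvPolynomial.aeval (R := ℂ) _).range ≤ _) ⟨F₀, rfl⟩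
  rw [aeval_range, Algebra.adjoin_le_iff]
  rintro _ ⟨d, rfl⟩
  simp only [Function.comp_apply]
  refine Subalgebra.sum_mem _ fun e _ => ?_
  by_cases he : ∀ i, ¬ p i → e.1 i = 0
  · exact Subalgebra.smul_mem _ ((MvPolynomial.X_mem_supported (R := ℂ)
        (s := {d : DegIdx (MatIdx m) m | ∀ i, ¬ p i → d.1 i = 0}) (i := e)).mpr he) _
  · rw [key d.1 e d.2 he, zero_smul]
    exact Subalgebra.zero_mem _

/-- Coefficients after a diagonal substitution: `coeff_d (diag(β) · P) = (∏ β_i^{d_i}) coeff_d P`. [folklore] -/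
theorem frb_coeff_linSubst_diagonal (β : MatIdx m → ℂ) (P : MvPolynomial (MatIdx m) ℂ) (d : MatIdx m →₀ ℕ) :
    coeff d (linSubst (MatIdx m) ℂ (Matrix.diagonal β) P) = (d.prod fun i n => β i ^ n) * coeff d P := by
  classical
  induction P using MvPolynomial.induction_on' with
  | monomial u a =>
    rw [linSubst_diagonal_monomial, coeff_smul, coeff_monomial, smul_eq_mul]
    split_ifs with h
    · subst h
      rfl
    · rw [mul_zero, mul_zero]
  | add P Q hP hQ => rw [map_add, coeff_add, coeff_add, hP, hQ, mul_add]

/-- **`Φ` maps polynomials in the kept coefficients to functions of the kept rows.**  For `F` in the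
coefficients of the monomials in the kept variables, `Φ F (A) = F(A · f)` only depends on the kept rows of
`A`: killing the other rows of `A` kills exactly the non-kept variables after the substitution
(`linSubst (diag 1_K · A) = linSubst (diag 1_K) ∘ linSubst A`), which does not change kept coefficients.
[folklore; Mulmuley–Sohoni 2001 §4] -/
theorem frb_genericOrbitMap_mem_supported (p : MatIdx m → Prop) [DecidablePred p] (f : MvPolynomial (MatIdx m) ℂ)
    {F : MvPolynomial (DegIdx (MatIdx m) m) ℂ}
    (hF : F ∈ MvPolynomial.supported ℂ {d : DegIdx (MatIdx m) m | ∀ i, ¬ p i → d.1 i = 0}) :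
    genericOrbitMap f m F ∈ MvPolynomial.supported ℂ {q : MatIdx m × MatIdx m | p q.1} := by
  classical
  rw [supported_eq_range_rename, AlgHom.mem_range] at hF
  obtain ⟨F₀, rfl⟩ := hF
  change genericOrbitMap f m (rename (Subtype.val : {d : DegIdx (MatIdx m) m // ∀ i, ¬ p i → d.1 i = 0} →
    DegIdx (MatIdx m) m) F₀) ∈ _
  -- the kept-row projection `κ` of `R` and its range
  set κ : MatIdx m × MatIdx m → MvPolynomial (MatIdx m × MatIdx m) ℂ :=
    fun q => if p q.1 then X q else 0 with hκ
  have hκrange : (MvPolynomial.aeval (R := ℂ) κ).range ≤ MvPolynomial.supported ℂ {q : MatIdx m × MatIdx m | p q.1} := by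
    rw [aeval_range, Algebra.adjoin_le_iff]
    rintro _ ⟨q, rfl⟩
    by_cases hq : p q.1
    · simp only [hκ, if_pos hq]
      exact (MvPolynomial.X_mem_supported (R := ℂ) (s := {q : MatIdx m × MatIdx m | p q.1}) (i := q)).mpr hq
    · simp only [hκ, if_neg hq]
      exact Subalgebra.zero_mem _
  -- each kept coefficient function `Φ (X d)` is fixed by `κ`
  have hfix : ∀ d : DegIdx (MatIdx m) m, (∀ i, ¬ p i → d.1 i = 0) →
      MvPolynomial.aeval κ (genericOrbitMap f m (X d)) = genericOrbitMap f m (X d) := by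
    intro d hd
    apply MvPolynomial.funext
    intro x
    rw [frb_eval_aeval]
    have hx' : (fun q : MatIdx m × MatIdx m => MvPolynomial.eval x (κ q)) =
        fun ij : MatIdx m × MatIdx m => (Matrix.diagonal (fun i : MatIdx m => if p i then (1 : ℂ) else 0) *
          Matrix.of (fun i j : MatIdx m => x (i, j))) ij.1 ij.2 := by
      funext q
      simp only [hκ, Matrix.diagonal_mul, Matrix.of_apply]
      split_ifs <;> simp
    have hx : MvPolynomial.eval x (genericOrbitMap f m (X d)) =
        MvPolynomial.eval (fun ij : MatIdx m × MatIdx m => Matrix.of (fun i j : MatIdx m => x (i, j)) ij.1 ij.2)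
          (genericOrbitMap f m (X d)) := rfl
    rw [hx', eval_genericOrbitMap, hx, eval_genericOrbitMap, aeval_X, aeval_X, formCoeff_apply, formCoeff_apply,
      linSubst_mul, AlgHom.comp_apply, frb_coeff_linSubst_diagonal]
    have hprod : (d.1.prod fun i n => (if p i then (1 : ℂ) else 0) ^ n) = 1 := by
      rw [Finsupp.prod]
      refine Finset.prod_eq_one fun i hi => ?_
      have hpi : p i := by
        by_contra hpi
        exact (Finsupp.mem_support_iff.mp hi) (hd i hpi)
      rw [if_pos hpi, one_pow]
    rw [hprod, one_mul]
  -- conclude by the range of `aeval (Φ ∘ X ∘ val)`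
  simp only [genericOrbitMap, aeval_rename]
  have hrange : (MvPolynomial.aeval (R := ℂ) ((fun d : DegIdx (MatIdx m) m =>
      coeff d.1 (linSubst (MatIdx m) (MvPolynomial (MatIdx m × MatIdx m) ℂ) (Matrix.mvPolynomialX (MatIdx m) (MatIdx m) ℂ)
        (map (C : ℂ →+* MvPolynomial (MatIdx m × MatIdx m) ℂ) f))) ∘
      (Subtype.val : {d : DegIdx (MatIdx m) m // ∀ i, ¬ p i → d.1 i = 0} → DegIdx (MatIdx m) m))).range ≤
      MvPolynomial.supported ℂ {q : MatIdx m × MatIdx m | p q.1} := by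
    rw [aeval_range, Algebra.adjoin_le_iff]
    rintro _ ⟨d, rfl⟩
    have h1 : ((fun d : DegIdx (MatIdx m) m =>
        coeff d.1 (linSubst (MatIdx m) (MvPolynomial (MatIdx m × MatIdx m) ℂ) (Matrix.mvPolynomialX (MatIdx m) (MatIdx m) ℂ)
          (map (C : ℂ →+* MvPolynomial (MatIdx m × MatIdx m) ℂ) f))) ∘
        (Subtype.val : {d : DegIdx (MatIdx m) m // ∀ i, ¬ p i → d.1 i = 0} → DegIdx (MatIdx m) m)) d =
        genericOrbitMap f m (X d.1) := by
      rw [genericOrbitMap, aeval_X]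
      rfl
    rw [h1, ← hfix d.1 d.2]
    exact hκrange ⟨_, rfl⟩
  exact hrange ⟨F₀, rfl⟩

/-- **A Borel semi-invariant in the image of `Φ` is the image of a highest-weight class.**  If
`Φ F` satisfies the crux's Borel clause with weight `χ`, then the class of `F` in `ℂ[Δ_m(f)]` is a
highest-weight vector of weight `χ` (`orbitCoordToPoly` is injective and `Φ (b · F) = (Φ F)(b⁻¹ ·)`).
Mulmuley–Sohoni 2001 §5; BLMW 2011 §5.2. [folklore] -/
theorem frb_mk_mem_highestWeightSpace (f : MvPolynomial (MatIdx m) ℂ) (χ : Weight (MatIdx m))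
    {F : MvPolynomial (DegIdx (MatIdx m) m) ℂ}
    (h : ∀ g : GL (MatIdx m) ℂ, IsUpperTriangular g →
      MvPolynomial.aeval (R := ℂ) (fun q : MatIdx m × MatIdx m =>
        ∑ l : MatIdx m, ((g⁻¹ : GL (MatIdx m) ℂ) : Matrix (MatIdx m) (MatIdx m) ℂ) q.1 l •
          (X (l, q.2) : MvPolynomial (MatIdx m × MatIdx m) ℂ)) (genericOrbitMap f m F) =
        weightChar χ g • genericOrbitMap f m F) :
    Ideal.Quotient.mk (orbitVanishingIdeal f m) F ∈ highestWeightSpace (orbitCoordRep f m) χ := by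
  rw [mem_highestWeightSpace_iff]
  intro g hg
  apply orbitCoordToPoly_injective f m
  rw [orbitCoordRep_apply, orbitCoordSubst_mk, orbitCoordToPoly_mk, map_smul, orbitCoordToPoly_mk,
    ← frb_leftAct_inv_genericOrbitMap, h g hg]

/-- **Multiplicity bound for Borel semi-invariants inside `Φ(N)`.**  For `m ≠ 0`, the space of
`B`-semi-invariants of weight `χ` (crux Borel clause) lying in `Φ(N)` (`N ⊆ R_coef` any subspace) has
dimension at most `orbitMultiplicity ℂ f m χ`: it lies in the (injective) image under `orbitCoordToPoly`
of the highest-weight space of weight `χ` of `ℂ[Δ_m(f)]`, which is finite-dimensional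
(`finiteDimensional_highestWeightSpace_orbitCoordRep_holds`).  BLMW 2011 §5.2. [folklore] -/
theorem frb_finrank_hwsp_inf_map_le_orbitMultiplicity (f : MvPolynomial (MatIdx m) ℂ) (hm : m ≠ 0)
    (χ : Weight (MatIdx m)) (N : Submodule ℂ (MvPolynomial (DegIdx (MatIdx m) m) ℂ)) :
    Module.finrank ℂ ↥((⨅ (g : Matrix.GeneralLinearGroup (MatIdx m) ℂ) (_ : IsUpperTriangular g),
          LinearMap.ker ((MvPolynomial.aeval fun q : MatIdx m × MatIdx m =>
              ∑ l : MatIdx m, ((g⁻¹ : Matrix.GeneralLinearGroup (MatIdx m) ℂ) :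
                Matrix (MatIdx m) (MatIdx m) ℂ) q.1 l •
                  (MvPolynomial.X (l, q.2) : MvPolynomial (MatIdx m × MatIdx m) ℂ)).toLinearMap -
            weightChar χ g •
              (LinearMap.id : MvPolynomial (MatIdx m × MatIdx m) ℂ →ₗ[ℂ] MvPolynomial (MatIdx m × MatIdx m) ℂ))) ⊓
        N.map (genericOrbitMap f m).toLinearMap) ≤
      orbitMultiplicity ℂ f m χ := by
  haveI := finiteDimensional_highestWeightSpace_orbitCoordRep_holds (k := ℂ) f hm χ
  have hle : (⨅ (g : Matrix.GeneralLinearGroup (MatIdx m) ℂ) (_ : IsUpperTriangular g),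
          LinearMap.ker ((MvPolynomial.aeval fun q : MatIdx m × MatIdx m =>
              ∑ l : MatIdx m, ((g⁻¹ : Matrix.GeneralLinearGroup (MatIdx m) ℂ) :
                Matrix (MatIdx m) (MatIdx m) ℂ) q.1 l •
                  (MvPolynomial.X (l, q.2) : MvPolynomial (MatIdx m × MatIdx m) ℂ)).toLinearMap -
            weightChar χ g •
              (LinearMap.id : MvPolynomial (MatIdx m × MatIdx m) ℂ →ₗ[ℂ] MvPolynomial (MatIdx m × MatIdx m) ℂ))) ⊓
        N.map (genericOrbitMap f m).toLinearMap ≤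
      (highestWeightSpace (orbitCoordRep f m) χ).map (orbitCoordToPoly f m).toLinearMap := by
    rintro G ⟨hG, ⟨F, -, rfl⟩⟩
    refine ⟨Ideal.Quotient.mk _ F, frb_mk_mem_highestWeightSpace f χ (fun g hg => ?_), orbitCoordToPoly_mk f m F⟩
    have h1 := (Submodule.mem_iInf _).mp hG g
    have h2 := (Submodule.mem_iInf _).mp h1 hg
    rw [LinearMap.mem_ker, LinearMap.sub_apply, sub_eq_zero] at h2
    exact h2
  calc Module.finrank ℂ _ ≤ Module.finrank ℂ ↥((highestWeightSpace (orbitCoordRep f m) χ).map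
        (orbitCoordToPoly f m).toLinearMap) := Submodule.finrank_mono hle
    _ ≤ Module.finrank ℂ ↥(highestWeightSpace (orbitCoordRep f m) χ) := Submodule.finrank_map_le _ _
    _ = orbitMultiplicity ℂ f m χ := rfl

/-- **Weight pinning on the per side.**  A nonzero `B`-semi-invariant `Φ F` (crux Borel clause, weight
`χ`) with `F` a form of degree `δ` on `Sym^m W`, `f = X₀₀^{m-n} per_n`, forces `χ = λ*` for a partition
`λ ⊢ mδ` with at most `m²` parts (`exists_eq_toMatIdx_of_hasHighestWeight_paddedPerOrbitRep`; the degree is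
pinned by `size_eq_of_mem_orbitCoordRingDeg_of_mem_highestWeightSpace`).  BLMW 2011 §5.2, (5.2.2). [folklore] -/
theorem frb_exists_partition_of_hwv (n : ℕ) [NeZero m] (δ : ℕ) (χ : Weight (MatIdx m))
    {F : MvPolynomial (DegIdx (MatIdx m) m) ℂ}
    (hF : F ∈ MvPolynomial.homogeneousSubmodule (DegIdx (MatIdx m) m) ℂ δ)
    (h0 : genericOrbitMap (paddedPerFormLex ℂ n m) m F ≠ 0)
    (h : ∀ g : GL (MatIdx m) ℂ, IsUpperTriangular g →
      MvPolynomial.aeval (R := ℂ) (fun q : MatIdx m × MatIdx m =>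
        ∑ l : MatIdx m, ((g⁻¹ : GL (MatIdx m) ℂ) : Matrix (MatIdx m) (MatIdx m) ℂ) q.1 l •
          (X (l, q.2) : MvPolynomial (MatIdx m × MatIdx m) ℂ)) (genericOrbitMap (paddedPerFormLex ℂ n m) m F) =
        weightChar χ g • genericOrbitMap (paddedPerFormLex ℂ n m) m F) :
    ∃ lam : Nat.Partition (m * δ), lam.parts.card ≤ m * m ∧
      χ = ((Weight.dualOfPartition (m * m) lam).toMatIdx : Weight (MatIdx m)) := by
  set x : OrbitCoordRing (paddedPerFormLex ℂ n m) m :=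
    Ideal.Quotient.mk (orbitVanishingIdeal (paddedPerFormLex ℂ n m) m) F with hxdef
  have hx : x ∈ highestWeightSpace (orbitCoordRep (paddedPerFormLex ℂ n m) m) χ :=
    frb_mk_mem_highestWeightSpace _ χ h
  have hxd : x ∈ orbitCoordRingDeg (paddedPerFormLex ℂ n m) m δ :=
    mem_orbitCoordRingDeg_iff.mpr ⟨F, (mem_homogeneousSubmodule _ _).mp hF, rfl⟩
  have hx0 : x ≠ 0 := by
    intro hx0
    apply h0
    rw [← orbitCoordToPoly_mk, ← hxdef, hx0, map_zero]
  have hhw : HasHighestWeight (paddedPerOrbitRep ℂ n m) χ := (hasHighestWeight_iff_exists _ _).mpr ⟨x, hx0, hx⟩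
  obtain ⟨d, lam, hlamN, rfl⟩ := exists_eq_toMatIdx_of_hasHighestWeight_paddedPerOrbitRep hhw
  have hsize := size_eq_of_mem_orbitCoordRingDeg_of_mem_highestWeightSpace (paddedPerFormLex ℂ n m) hxd hx hx0
  have hd : m * d = m * δ := by
    have h' := (size_toMatIdx_dualOfPartition m lam hlamN).symm.trans hsize
    exact_mod_cast neg_injective h'
  obtain rfl : d = δ := Nat.eq_of_mul_eq_mul_left (Nat.pos_of_ne_zero (NeZero.ne m)) hd
  exact ⟨lam, hlamN, rfl⟩

/-- If the transported dual weight `λ*` of a partition with at most `m²` parts vanishes at every slot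
outside the last `L` (slots `a` with `idx(a) + L < m²`), then `λ` has at most `L` parts
(`card_parts_le_of_dualOfPartition_apply_eq_zero` transported along `matIdxEquiv`). [folklore] -/
theorem frb_card_parts_le_of_toMatIdx_eq_zero {D L : ℕ} (lam : Nat.Partition D) (hlamN : lam.parts.card ≤ m * m)
    (h : ∀ a : MatIdx m, ¬ (m * m ≤ (((matIdxEquiv m).symm a : Fin (m * m)) : ℕ) + L) →
      ((Weight.dualOfPartition (m * m) lam).toMatIdx : Weight (MatIdx m)) a = 0) :
    lam.parts.card ≤ L := by
  refine card_parts_le_of_dualOfPartition_apply_eq_zero lam hlamN fun i hi => ?_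
  have h1 := h (matIdxEquiv m i) (by rw [OrderIso.symm_apply_apply]; omega)
  change Weight.dualOfPartition (m * m) lam ((matIdxEquiv m).symm (matIdxEquiv m i)) = 0 at h1
  rwa [OrderIso.symm_apply_apply] at h1

end GenericOrbit

/-- **Per-side multiplicity bound for Borel semi-invariants inside the generic-orbit image**
(registered sub-goal of `stub_fourRowBridge`, line four-row-count).  For a form `f` on `W = ℂ^{m×m}`,
`m ≠ 0`, and any subspace `N` of `ℂ[Sym^m W]`, the `B`-semi-invariants of weight `χ` for the crux's
Borel clause (left translation `G ↦ G(g⁻¹ ·)`) lying in `genericOrbitMap f m (N) ⊆ ℂ[End W]` span a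
space of dimension at most `orbitMultiplicity ℂ f m χ` — they are images of highest-weight classes of
`ℂ[Δ_m(f)]` under the injective equivariant `orbitCoordToPoly`.  (With `N` = degree-`δ` polynomials in
the kept coefficients this is the per-side inequality `hwMult ≤ mult_{λ*} ℂ[Δ_m(X₀₀^{m-n} per_n)]` of the
four-row bridge.)  Mulmuley–Sohoni 2001 §5; BLMW 2011 §5.2. [folklore] -/
theorem fourRow_hwsp_inf_map_genericOrbitMap_le_orbitMultiplicity {m : ℕ} (f : MvPolynomial (MatIdx m) ℂ)
    (hm : m ≠ 0) (χ : Weight (MatIdx m)) (N : Submodule ℂ (MvPolynomial (DegIdx (MatIdx m) m) ℂ)) :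
    Module.finrank ℂ ↥((⨅ (g : Matrix.GeneralLinearGroup (MatIdx m) ℂ) (_ : IsUpperTriangular g),
          LinearMap.ker ((MvPolynomial.aeval fun q : MatIdx m × MatIdx m =>
              ∑ l : MatIdx m, ((g⁻¹ : Matrix.GeneralLinearGroup (MatIdx m) ℂ) :
                Matrix (MatIdx m) (MatIdx m) ℂ) q.1 l •
                  (MvPolynomial.X (l, q.2) : MvPolynomial (MatIdx m × MatIdx m) ℂ)).toLinearMap -
            weightChar χ g •
              (LinearMap.id : MvPolynomial (MatIdx m × MatIdx m) ℂ →ₗ[ℂ] MvPolynomial (MatIdx m × MatIdx m) ℂ))) ⊓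
        N.map (genericOrbitMap f m).toLinearMap) ≤
      orbitMultiplicity ℂ f m χ :=
  frb_finrank_hwsp_inf_map_le_orbitMultiplicity f hm χ N

end

end Summit.ValiantsHypothesis.ValiantsHypothesis.Theorems.ValuativeFlip
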